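import Mathlib.Analysis.Distribution.SchwartzSpace.Basic
import HarnessLib

/-!
# Seminorm bounds for Schwartz functions composed with continuous linear equivalences

Analysis/FunctionSpaces support file (everything proved, no definitions). Mathlib's
`SchwartzMap.compCLMOfContinuousLinearEquiv` composes a Schwartz function with a continuous linear
equivalence `g : D ≃L E`; this file records the quantitative bound

  `p_{k,n}(f ∘ g) ≤ ‖g⁻¹‖ᵏ ‖g‖ⁿ p_{k,n}(f)`   (`seminorm_compCLMOfContinuousLinearEquiv_le`),

from `‖x‖ ≤ ‖g⁻¹‖ ‖g x‖` and `Dⁿ(f ∘ g)(x) = Dⁿf(gx) ∘ (g, …, g)`. Used to transport Schwartz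
seminorm estimates along linear changes of coordinates (gaps ↔ point times, Euclidean ↔ sup-norm
models) in the Osterwalder–Schrader regularisation estimates (Comm. Math. Phys. 42 (1975), Ch. VI).
-/

noncomputable section

open scoped SchwartzMap

namespace Literature.Analysis.FunctionSpaces

variable {D E F : Type*} [NormedAddCommGroup D] [NormedSpace ℝ D] [NormedAddCommGroup E] [NormedSpace ℝ E]
  [NormedAddCommGroup F] [NormedSpace ℝ F]

/-- **Seminorms of a Schwartz function composed with a continuous linear equivalence**:
`p_{k,n}(f ∘ g) ≤ ‖g⁻¹‖ᵏ ‖g‖ⁿ p_{k,n}(f)`. [folklore] -/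
theorem seminorm_compCLMOfContinuousLinearEquiv_le (g : D ≃L[ℝ] E) (f : 𝓢(E, F)) (k n : ℕ) :
    SchwartzMap.seminorm ℝ k n (SchwartzMap.compCLMOfContinuousLinearEquiv ℝ g f) ≤
      ‖(g.symm : E →L[ℝ] D)‖ ^ k * ‖(g : D →L[ℝ] E)‖ ^ n * SchwartzMap.seminorm ℝ k n f := by
  refine SchwartzMap.seminorm_le_bound ℝ k n _ (by positivity) fun x => ?_
  have hfun : ⇑(SchwartzMap.compCLMOfContinuousLinearEquiv ℝ g f) = (f : E → F) ∘ (g : D →L[ℝ] E) := by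
    funext y; simp
  rw [hfun, (g : D →L[ℝ] E).iteratedFDeriv_comp_right (f.smooth n) x (i := n) (by exact_mod_cast le_rfl)]
  have h1 : ‖(iteratedFDeriv ℝ n f (g x)).compContinuousLinearMap fun _ => (g : D →L[ℝ] E)‖ ≤
      ‖iteratedFDeriv ℝ n f (g x)‖ * ‖(g : D →L[ℝ] E)‖ ^ n := by
    refine (ContinuousMultilinearMap.norm_compContinuousLinearMap_le _ _).trans ?_
    simp [Finset.prod_const]
  have hx : ‖x‖ ≤ ‖(g.symm : E →L[ℝ] D)‖ * ‖g x‖ := by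
    calc ‖x‖ = ‖(g.symm : E →L[ℝ] D) (g x)‖ := by simp
      _ ≤ ‖(g.symm : E →L[ℝ] D)‖ * ‖g x‖ := ContinuousLinearMap.le_opNorm _ _
  have hle := SchwartzMap.le_seminorm ℝ k n f (g x)
  calc ‖x‖ ^ k * ‖(iteratedFDeriv ℝ n f (g x)).compContinuousLinearMap fun _ => (g : D →L[ℝ] E)‖
      ≤ (‖(g.symm : E →L[ℝ] D)‖ * ‖g x‖) ^ k * (‖iteratedFDeriv ℝ n f (g x)‖ * ‖(g : D →L[ℝ] E)‖ ^ n) := by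
        gcongr
    _ = ‖(g.symm : E →L[ℝ] D)‖ ^ k * ‖(g : D →L[ℝ] E)‖ ^ n * (‖g x‖ ^ k * ‖iteratedFDeriv ℝ n f (g x)‖) := by
        rw [mul_pow]; ring
    _ ≤ ‖(g.symm : E →L[ℝ] D)‖ ^ k * ‖(g : D →L[ℝ] E)‖ ^ n * SchwartzMap.seminorm ℝ k n f := by
        gcongr

end Literature.Analysis.FunctionSpaces
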